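import Literature.Topology.FourManifolds.LevelComparison
import Literature.Topology.FourManifolds.CollarUniquenessBall
import HarnessLib

/-!
# Splicing two functions below a common regular level without creating critical points

Topic `Literature/Topology/FourManifolds` (fact seat
`provefact-Literature.Topology.FourManifolds.IsHandlebody.exists_diffeomorph_isBoundaryGluing_sphere`,
step F2b₁ of the Lickorish–Wallace DAG; third layer of the *level normalisation* feeding L1
`oneHandle_nonempty_diffeomorph` into the level-compatible handle-extension step
`HandleStepAssembly.lean`).  Everything here is **proved**; no named facts.

Let `c : LevelComparison k M M'` (`LevelComparison.lean`): smooth `f` on `M`, a regular level `a`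
with `{f ≤ a}` in the interior, a diffeomorphism `Ψ₀ : {f ≤ a} ≅ {f' ≤ a'}` onto a regular
sublevel set of `f'` on `M'`, and the smooth comparison function `G` (`= f' ∘ Ψ₀` on `{f ≤ a}`).
We **splice** `f` (kept near and above the level) with `G + (a - a')` (used deeper inside):

  `F = f + β(a - f) · (G + (a - a') - f)`,  `β = spliceProfile L s₀`,

where the **log-slow profile** `β` vanishes for depths `t ≤ s₁ = s₀ e^{-L}`, equals `1` for
`t ≥ s₀`, and satisfies `|t β'(t)| ≤ C₀ / L` (it is `1 - logCutoff L (t / s₀e^{L})`, with the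
log-slow cutoff of `CollarUniquenessBall.lean`).  Then (`LevelComparison.splice`):

* `F` is smooth, `F = f` on `{a - s₁ ≤ f}` (so near the level, above it, and near `∂M`), and
  `F = G + (a - a') = f' ∘ Ψ₀ + (a - a')` on `{f ≤ a - s₀}`; on the collar in between `F` is a
  convex combination of the two (`splice_eq_f`, `splice_eq_G`, `min_le_splice`);
* **no critical points are created** (`not_isMCriticalPt_splice`): on a collar
  `{a - s₀ ≤ f < a}` covered by finitely many chart balls of `LevelComparison.exists_ball_bounds`
  (`exists_collar`, compactness of the level), in the straightening chart
  `∂₀(F ∘ Θ⁻¹) = -(1 - β) + β ∂₀(G ∘ Θ⁻¹) + β'(z₀)(G ∘ Θ⁻¹ - a' + z₀) ≤ -min(1, λ) + C C₀ / L < 0`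
  once `L > C C₀ / min(1, λ)` — the normal derivatives of `f` and `G` have the same sign on the
  level (`λ > 0`), and the error term is small *because the cutoff is slow on a logarithmic
  scale* while `G ∘ Θ⁻¹ - a' + z₀ = O(z₀)` (Hadamard bound).

This is the function-side form of the normalisation "the diffeomorphism may be assumed to
preserve the levels near the boundary" in Milnor's proof of Thm. 3.13 (*Lectures on the
h-cobordism theorem* (1965), PDF pp. 18–19) and Kosinski, *Differential Manifolds* (1993),
VI §7 / VII §2; the same logarithmic device as in the uniqueness of collars
(`CollarUniquenessBall.lean`, `CollarGerm.lean`; Hirsch (1976), Ch. 8, Thm. 1.8).  The sequel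
identifies the sublevel sets of `F` below the collar with those of `f'` through `Ψ₀`.

## References

* J. Milnor, *Lectures on the h-cobordism theorem* (1965), Lemma 2.9, proof of Thm. 3.13.
  [MilnorHCobordism1965]
* A. A. Kosinski, *Differential Manifolds* (1993), VI §7, VII §2. [Kosinski1993]
* M. W. Hirsch, *Differential Topology*, GTM 33 (1976), Ch. 8 §1, Thm. 1.8. [HirschDT1976]
-/

open scoped Manifold ContDiff Topology
open Set Function Filter Metric Real

noncomputable section

namespace Literature.Topology.FourManifolds

universe u

/-- Local notation: `𝔼 n` is the model Euclidean space `EuclideanSpace ℝ (Fin n)`. -/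
local notation "𝔼 " n:arg => EuclideanSpace ℝ (Fin n)
/-- Local notation: `ℍ n` is the model half-space `EuclideanHalfSpace n`. -/
local notation "ℍ " n:arg => EuclideanHalfSpace n

/-! ### §1 The log-slow blending profile -/

section Profile

variable {L s₀ t : ℝ}

/-- The **log-slow blending profile** `β_{L,s₀}`: `0` for `t ≤ s₀ e^{-L}`, and
`1 - logCutoff L (t / (s₀ e^{L}))` beyond; it rises from `0` (depths `≤ s₀ e^{-L}`) to `1`
(depths `≥ s₀`) so slowly that `|t β'(t)| ≤ C₀ / L`. [folklore] -/
def spliceProfile (L s₀ t : ℝ) : ℝ :=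
  if t ≤ s₀ * exp (-L) then 0 else 1 - logCutoff L (t / (s₀ * exp L))

/-- The scale `T = s₀ e^{L}` is positive. [folklore] -/
theorem spliceScale_pos (hs₀ : 0 < s₀) : 0 < s₀ * exp L := mul_pos hs₀ (exp_pos L)

/-- `β = 0` for `t ≤ s₀ e^{-L}`. [folklore] -/
theorem spliceProfile_of_le (h : t ≤ s₀ * exp (-L)) : spliceProfile L s₀ t = 0 := if_pos h

/-- On `t > 0`, `β t = 1 - logCutoff L (t / (s₀ e^{L}))` (also below `s₀ e^{-L}`, where the
cutoff is `1`). [folklore] -/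
theorem spliceProfile_of_pos (hL : 0 < L) (hs₀ : 0 < s₀) (ht : 0 < t) :
    spliceProfile L s₀ t = 1 - logCutoff L (t / (s₀ * exp L)) := by
  unfold spliceProfile
  split_ifs with h
  · have hT := spliceScale_pos (L := L) hs₀
    have h1 : logCutoff L (t / (s₀ * exp L)) = 1 := by
      refine logCutoff_eq_one hL (div_pos ht hT) ?_
      rw [div_le_iff₀ hT]
      calc t ≤ s₀ * exp (-L) := h
        _ = exp (-2 * L) * (s₀ * exp L) := by
          rw [mul_left_comm, ← exp_add]; congr 1; congr 1; ring
    rw [h1, sub_self]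
  · rfl

/-- `β = 1` for `t ≥ s₀`. [folklore] -/
theorem spliceProfile_of_ge (hL : 0 < L) (hs₀ : 0 < s₀) (h : s₀ ≤ t) : spliceProfile L s₀ t = 1 := by
  have ht : 0 < t := hs₀.trans_le h
  rw [spliceProfile_of_pos hL hs₀ ht, logCutoff_eq_zero hL, sub_zero]
  rw [le_div_iff₀ (spliceScale_pos hs₀)]
  calc exp (-L) * (s₀ * exp L) = s₀ := by rw [mul_comm, mul_assoc, ← exp_add]; simp
    _ ≤ t := h

/-- `β ∈ [0, 1]`. [folklore] -/
theorem spliceProfile_mem_Icc (L s₀ t : ℝ) : spliceProfile L s₀ t ∈ Icc (0 : ℝ) 1 := by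
  unfold spliceProfile
  split_ifs
  · exact ⟨le_rfl, zero_le_one⟩
  · have := logCutoff_mem_Icc L (t / (s₀ * exp L))
    exact ⟨by linarith [this.2], by linarith [this.1]⟩

/-- `β` is smooth at positive `t`. [folklore] -/
theorem contDiffAt_spliceProfile_of_pos (hL : 0 < L) (hs₀ : 0 < s₀) (ht : 0 < t) :
    ContDiffAt ℝ ∞ (spliceProfile L s₀) t := by
  have hev : spliceProfile L s₀ =ᶠ[𝓝 t] fun u => 1 - logCutoff L (u / (s₀ * exp L)) := by
    filter_upwards [Ioi_mem_nhds ht] with u hu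
    exact spliceProfile_of_pos hL hs₀ hu
  refine ContDiffAt.congr_of_eventuallyEq ?_ hev
  have hT := spliceScale_pos (L := L) hs₀
  have h2 : ContDiffAt ℝ ∞ (fun u => logCutoff L (u / (s₀ * exp L))) t :=
    ContDiffAt.comp (g := logCutoff L) (f := fun u : ℝ => u / (s₀ * exp L)) t
      (contDiffAt_logCutoff (div_pos ht hT).ne') (contDiffAt_id.div_const (s₀ * exp L))
  exact contDiffAt_const.sub h2

/-- **`β` is smooth.** [folklore] -/
theorem contDiff_spliceProfile (hL : 0 < L) (hs₀ : 0 < s₀) : ContDiff ℝ ∞ (spliceProfile L s₀) := by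
  rw [contDiff_iff_contDiffAt]
  intro t
  by_cases ht : t < s₀ * exp (-L)
  · have hev : spliceProfile L s₀ =ᶠ[𝓝 t] fun _ => 0 := by
      filter_upwards [Iio_mem_nhds ht] with u hu
      exact spliceProfile_of_le hu.le
    exact contDiffAt_const.congr_of_eventuallyEq hev
  · exact contDiffAt_spliceProfile_of_pos hL hs₀ ((mul_pos hs₀ (exp_pos _)).trans_le (not_lt.1 ht))

/-- The derivative of `β` at `t > 0`. [folklore] -/
theorem hasDerivAt_spliceProfile (hL : 0 < L) (hs₀ : 0 < s₀) (ht : 0 < t) :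
    HasDerivAt (spliceProfile L s₀)
      (-(deriv (logCutoff L) (t / (s₀ * exp L)) * (s₀ * exp L)⁻¹)) t := by
  have hT := spliceScale_pos (L := L) hs₀
  have hev : spliceProfile L s₀ =ᶠ[𝓝 t] fun u => 1 - logCutoff L (u / (s₀ * exp L)) := by
    filter_upwards [Ioi_mem_nhds ht] with u hu
    exact spliceProfile_of_pos hL hs₀ hu
  refine HasDerivAt.congr_of_eventuallyEq ?_ hev
  have h1 : HasDerivAt (fun u : ℝ => u / (s₀ * exp L)) (s₀ * exp L)⁻¹ t := by
    simpa [div_eq_mul_inv] using (hasDerivAt_id t).mul_const (s₀ * exp L)⁻¹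
  have h2 : HasDerivAt (logCutoff L) (deriv (logCutoff L) (t / (s₀ * exp L))) (t / (s₀ * exp L)) :=
    (hasDerivAt_logCutoff (div_pos ht hT).ne').differentiableAt.hasDerivAt
  have h3 := (h2.comp t h1).const_sub 1
  simpa using h3

/-- **Key estimate**: `|t β'(t)| ≤ C₀ / L` for `t > 0`. [folklore] -/
theorem abs_mul_deriv_spliceProfile_le (hL : 0 < L) (hs₀ : 0 < s₀) (ht : 0 < t) :
    |t * deriv (spliceProfile L s₀) t| ≤ smoothTransitionDerivBound / L := by
  have hT := spliceScale_pos (L := L) hs₀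
  rw [(hasDerivAt_spliceProfile hL hs₀ ht).deriv]
  have heq : t * -(deriv (logCutoff L) (t / (s₀ * exp L)) * (s₀ * exp L)⁻¹) =
      -((t / (s₀ * exp L)) * deriv (logCutoff L) (t / (s₀ * exp L))) := by ring
  rw [heq, abs_neg]
  exact abs_mul_deriv_logCutoff_le hL (div_pos ht hT).ne'

end Profile

namespace LevelComparison

variable {k : ℕ} {M : Type u} [TopologicalSpace M] [ChartedSpace (ℍ (k + 1)) M] [IsManifold (𝓡∂ (k + 1)) ∞ M]
  {M' : Type u} [TopologicalSpace M'] [ChartedSpace (ℍ (k + 1)) M'] [IsManifold (𝓡∂ (k + 1)) ∞ M']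
  (c : LevelComparison k M M')

/-! ### §2 A collar below the level covered by good chart balls -/

/-- **A collar below the level inside finitely many good chart balls.**  For `M` compact there
are a collar width `s₀ > 0` and uniform constants `λ > 0`, `C ≥ 0` such that every point `x`
of the closed collar `{a - s₀ ≤ f ≤ a}` lies in the source of the straightening chart `Θ` of
some level point `p`, with `Θ x` in a ball `B(Θ p, r)`, `B̄ ⊆ Θ.target`, on which
`∂₀(G ∘ Θ⁻¹) ≤ -λ` and `|G ∘ Θ⁻¹ - a' + z₀| ≤ C z₀` (`z₀ ≥ 0`).  Proof: cover the compact level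
`{f = a}` by the chart balls of `exists_ball_bounds`, extract a finite subcover, and shrink
the collar into the union (a closed sublevel band disjoint from the level on which `f < a`
attains its maximum). [folklore] -/
theorem exists_collar [CompactSpace M] :
    ∃ s₀ lam C : ℝ, 0 < s₀ ∧ 0 < lam ∧ 0 ≤ C ∧
      ∀ x, c.a - s₀ ≤ c.f x → c.f x ≤ c.a →
        ∃ (p : M) (hp : c.f p = c.a) (r : ℝ),
          closedBall (c.chart p hp.le p) r ⊆ (c.chart p hp.le).target ∧
          x ∈ (c.chart p hp.le).source ∧ c.chart p hp.le x ∈ ball (c.chart p hp.le p) r ∧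
          (∀ z ∈ ball (c.chart p hp.le p) r, fderiv ℝ (c.G ∘ (c.chart p hp.le).symm) z e₀ ≤ -lam) ∧
          (∀ z ∈ ball (c.chart p hp.le p) r, 0 ≤ z 0 →
            |c.G ((c.chart p hp.le).symm z) - c.a' + z 0| ≤ C * z 0) := by
  classical
  set K : Set M := c.f ⁻¹' {c.a} with hK
  have hKc : IsCompact K := (isClosed_singleton.preimage c.hf.continuous).isCompact
  -- the chart balls at the level points
  have hdata : ∀ q : K, ∃ r lam C : ℝ, 0 < r ∧ 0 < lam ∧ 0 ≤ C ∧
      closedBall (c.chart q.1 (le_of_eq q.2) q.1) r ⊆ (c.chart q.1 (le_of_eq q.2)).target ∧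
      (∀ z ∈ ball (c.chart q.1 (le_of_eq q.2) q.1) r,
        fderiv ℝ (c.G ∘ (c.chart q.1 (le_of_eq q.2)).symm) z e₀ ≤ -lam) ∧
      (∀ z ∈ ball (c.chart q.1 (le_of_eq q.2) q.1) r, 0 ≤ z 0 →
        |c.G ((c.chart q.1 (le_of_eq q.2)).symm z) - c.a' + z 0| ≤ C * z 0) :=
    fun q => c.exists_ball_bounds q.1 q.2
  choose rf lamf Cf hrf hlamf hCf hballf hderf hhadf using hdata
  set U : K → Set M := fun q =>
    (c.chart q.1 (le_of_eq q.2)).source ∩ c.chart q.1 (le_of_eq q.2) ⁻¹' ball (c.chart q.1 (le_of_eq q.2) q.1) (rf q)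
    with hU
  have hUo : ∀ q, IsOpen (U q) := fun q =>
    (c.chart q.1 (le_of_eq q.2)).continuousOn.isOpen_inter_preimage (c.chart q.1 (le_of_eq q.2)).open_source
      isOpen_ball
  have hKU : K ⊆ ⋃ q, U q := by
    intro x hx
    refine mem_iUnion.2 ⟨⟨x, hx⟩, c.mem_chart_source x (le_of_eq hx), ?_⟩
    exact mem_ball_self (hrf ⟨x, hx⟩)
  obtain ⟨t, ht⟩ := hKc.elim_finite_subcover U hUo hKU
  -- uniform constants
  set lam : ℝ := (∑ q ∈ t, (lamf q)⁻¹ + 1)⁻¹ with hlam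
  set C : ℝ := ∑ q ∈ t, Cf q with hC
  have hsum : 0 ≤ ∑ q ∈ t, (lamf q)⁻¹ := Finset.sum_nonneg fun q _ => (inv_pos.2 (hlamf q)).le
  have hlam_pos : 0 < lam := by rw [hlam]; positivity
  have hlam_le : ∀ q ∈ t, lam ≤ lamf q := by
    intro q hq
    rw [hlam, inv_le_comm₀ (by positivity) (hlamf q)]
    have := Finset.single_le_sum (f := fun q => (lamf q)⁻¹) (fun q _ => (inv_pos.2 (hlamf q)).le) hq
    linarith
  have hC0 : 0 ≤ C := Finset.sum_nonneg fun q _ => hCf q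
  have hC_le : ∀ q ∈ t, Cf q ≤ C := fun q hq =>
    Finset.single_le_sum (f := fun q => Cf q) (fun q _ => hCf q) hq
  -- shrink the collar into the union
  set V : Set M := ⋃ q ∈ t, U q with hV
  have hVo : IsOpen V := isOpen_biUnion fun q _ => hUo q
  obtain ⟨s₀, hs₀, hcollar⟩ : ∃ s₀ > 0, ∀ x, c.a - s₀ ≤ c.f x → c.f x ≤ c.a → x ∈ V := by
    set A : Set M := c.f ⁻¹' Iic c.a \ V with hA
    have hAc : IsCompact A := ((isClosed_Iic.preimage c.hf.continuous).sdiff hVo).isCompact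
    have hAlt : ∀ x ∈ A, c.f x < c.a := by
      intro x hx
      refine lt_of_le_of_ne hx.1 fun h => hx.2 ?_
      exact ht h
    by_cases hAe : A = ∅
    · refine ⟨1, one_pos, fun x _ hx => ?_⟩
      by_contra hxV
      have : x ∈ A := ⟨hx, hxV⟩
      rw [hAe] at this; exact this
    · obtain ⟨x₀, hx₀, hmax⟩ := hAc.exists_isMaxOn (nonempty_iff_ne_empty.2 hAe) c.hf.continuous.continuousOn
      refine ⟨(c.a - c.f x₀) / 2, by linarith [hAlt x₀ hx₀], fun x h1 h2 => ?_⟩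
      by_contra hxV
      have := hmax ⟨h2, hxV⟩
      simp only [mem_setOf_eq] at this
      linarith [hAlt x₀ hx₀]
  refine ⟨s₀, lam, C, hs₀, hlam_pos, hC0, fun x h1 h2 => ?_⟩
  obtain ⟨q, hq, hxq⟩ := mem_iUnion₂.1 (hcollar x h1 h2)
  refine ⟨q.1, q.2, rf q, hballf q, hxq.1, hxq.2, fun z hz => (hderf q z hz).trans ?_, fun z hz hz0 =>
    (hhadf q z hz hz0).trans ?_⟩
  · linarith [hlam_le q hq]
  · exact mul_le_mul_of_nonneg_right (hC_le q hq) hz0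

/-! ### §3 The spliced function -/

section Splice

variable (L s₀ : ℝ)

/-- **The spliced function** `F = f + β(a - f) · (G + (a - a') - f)`, `β = spliceProfile L s₀`:
`f` near and above the level `a`, `G + (a - a') = f' ∘ Ψ₀ + (a - a')` below the collar.
[cite: MilnorHCobordism1965, proof of Thm. 3.13] -/
def splice (x : M) : ℝ :=
  c.f x + spliceProfile L s₀ (c.a - c.f x) * (c.G x + (c.a - c.a') - c.f x)

variable {L s₀}

/-- The spliced function is smooth. [folklore] -/
theorem contMDiff_splice (hL : 0 < L) (hs₀ : 0 < s₀) :
    ContMDiff (𝓡∂ (k + 1)) 𝓘(ℝ, ℝ) ∞ (c.splice L s₀) := by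
  have hβ : ContMDiff (𝓡∂ (k + 1)) 𝓘(ℝ, ℝ) ∞ fun x => spliceProfile L s₀ (c.a - c.f x) :=
    (contDiff_spliceProfile hL hs₀).comp_contMDiff (contMDiff_const.sub c.hf)
  exact c.hf.add (hβ.mul ((c.hG.add contMDiff_const).sub c.hf))

/-- `F = f` where `a - f ≤ s₀ e^{-L}` (near the level, above it, near `∂M`). [folklore] -/
theorem splice_eq_f {x : M} (h : c.a - s₀ * exp (-L) ≤ c.f x) : c.splice L s₀ x = c.f x := by
  unfold splice
  rw [spliceProfile_of_le (by linarith), zero_mul, add_zero]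

/-- `F = G + (a - a')` where `f ≤ a - s₀` (below the collar). [folklore] -/
theorem splice_eq_G (hL : 0 < L) (hs₀ : 0 < s₀) {x : M} (h : c.f x ≤ c.a - s₀) :
    c.splice L s₀ x = c.G x + (c.a - c.a') := by
  unfold splice
  rw [spliceProfile_of_ge hL hs₀ (by linarith), one_mul]
  ring

/-- `F` is a convex combination of `f` and `G + (a - a')`. [folklore] -/
theorem splice_eq_convex (x : M) :
    c.splice L s₀ x = (1 - spliceProfile L s₀ (c.a - c.f x)) * c.f x +
      spliceProfile L s₀ (c.a - c.f x) * (c.G x + (c.a - c.a')) := by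
  unfold splice; ring

/-- `min (f, G + (a - a')) ≤ F`. [folklore] -/
theorem min_le_splice (x : M) : min (c.f x) (c.G x + (c.a - c.a')) ≤ c.splice L s₀ x := by
  rw [c.splice_eq_convex]
  have hβ := spliceProfile_mem_Icc L s₀ (c.a - c.f x)
  nlinarith [min_le_left (c.f x) (c.G x + (c.a - c.a')), min_le_right (c.f x) (c.G x + (c.a - c.a')),
    hβ.1, hβ.2]

/-- `F ≤ max (f, G + (a - a'))`. [folklore] -/
theorem splice_le_max (x : M) : c.splice L s₀ x ≤ max (c.f x) (c.G x + (c.a - c.a')) := by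
  rw [c.splice_eq_convex]
  have hβ := spliceProfile_mem_Icc L s₀ (c.a - c.f x)
  nlinarith [le_max_left (c.f x) (c.G x + (c.a - c.a')), le_max_right (c.f x) (c.G x + (c.a - c.a')),
    hβ.1, hβ.2]

/-- **The splice has no critical point in a good chart ball** (pointwise form).  Let `x` lie in
the source of the straightening chart `Θ` of a level point `p`, with `Θ x` in a ball
`B(Θ p, r)` on which `∂₀(G ∘ Θ⁻¹) ≤ -λ` and `|G ∘ Θ⁻¹ - a' + z₀| ≤ C z₀`, and let `f x < a`.  If `C₀ C < L · min(1, λ)` then `x` is not a critical point of the spliced function: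
the derivative of `s ↦ (F ∘ Θ⁻¹)(Θ x + s e₀)` at `0` is
`-(1 - β) + β ∂₀(G ∘ Θ⁻¹) + β'(z₀)(G ∘ Θ⁻¹ - a' + z₀) ≤ -min(1, λ) + C₀ C / L < 0`.
[cite: MilnorHCobordism1965, proof of Thm. 3.13] -/
theorem not_isMCriticalPt_splice_of_ball (hL : 0 < L) (hs₀ : 0 < s₀) {lam C : ℝ}
    (hC : 0 ≤ C) (hLC : smoothTransitionDerivBound * C < L * min 1 lam)
    {p : M} (hp : c.f p = c.a) {r : ℝ}
    (hder : ∀ z ∈ ball (c.chart p hp.le p) r, fderiv ℝ (c.G ∘ (c.chart p hp.le).symm) z e₀ ≤ -lam)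
    (hhad : ∀ z ∈ ball (c.chart p hp.le p) r, 0 ≤ z 0 →
      |c.G ((c.chart p hp.le).symm z) - c.a' + z 0| ≤ C * z 0)
    {x : M} (hxs : x ∈ (c.chart p hp.le).source) (hxb : c.chart p hp.le x ∈ ball (c.chart p hp.le p) r)
    (hfx : c.f x < c.a) :
    ¬ IsMCriticalPt (𝓡∂ (k + 1)) (c.splice L s₀) x := by
  set Θ := c.chart p hp.le with hΘ
  set z : 𝔼 (k + 1) := Θ x with hz
  set Fc := c.splice L s₀ ∘ Θ.symm with hFc
  set Gc := c.G ∘ Θ.symm with hGc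
  set β := spliceProfile L s₀ with hβ
  have hzt : z ∈ Θ.target := Θ.map_source hxs
  have hz0 : z 0 = c.a - c.f x := c.chart_apply_zero p hp hxs
  have hz0pos : 0 < z 0 := by rw [hz0]; linarith
  -- `F ∘ Θ⁻¹` is smooth on the target
  have hFcs : ContDiffOn ℝ ∞ Fc Θ.target :=
    contMDiffOn_iff_contDiffOn.1 ((c.contMDiff_splice hL hs₀).comp_contMDiffOn
      (c.atlas.datum ⟨p, hp.le⟩).contMDiffOn_symm)
  have hFcd : HasFDerivAt Fc (fderiv ℝ Fc z) z :=
    ((hFcs.contDiffAt (Θ.open_target.mem_nhds hzt)).differentiableAt (by simp)).hasFDerivAt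
  -- criticality read in the chart
  rw [isMCriticalPt_iff_fderiv_comp_symm_eq_zero (c.atlas.datum ⟨p, hp.le⟩).contMDiffOn_toFun
    (c.atlas.datum ⟨p, hp.le⟩).contMDiffOn_symm hxs ((c.contMDiff_splice hL hs₀ x).mdifferentiableAt (by simp))]
  intro h0
  -- the line `s ↦ z + s e₀`
  set ℓ : ℝ → 𝔼 (k + 1) := fun s => z + s • e₀ with hℓ
  have hℓ0 : ℓ 0 = z := by simp [hℓ]
  have hℓs : ∀ s, ℓ s 0 = z 0 + s := fun s => by
    simp only [hℓ, PiLp.add_apply, PiLp.smul_apply, e₀_apply_zero, smul_eq_mul, mul_one]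
  have hℓd : HasDerivAt ℓ e₀ 0 := by
    have := ((hasDerivAt_id (0 : ℝ)).smul_const (e₀ : 𝔼 (k + 1))).const_add z
    simpa [hℓ] using this
  -- the derivative of `Fc ∘ ℓ` at `0` vanishes
  have hline0 : HasDerivAt (Fc ∘ ℓ) 0 0 := by
    have hFcd' : HasFDerivAt Fc (fderiv ℝ Fc (ℓ 0)) (ℓ 0) := by rw [hℓ0]; exact hFcd
    have h1 := hFcd'.comp_hasDerivAt 0 hℓd
    rw [hℓ0, h0, zero_apply] at h1
    exact h1
  -- `Gc` along the line
  have hG1 : HasDerivAt (Gc ∘ ℓ) (fderiv ℝ Gc z e₀) 0 := by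
    have hGcd' : HasFDerivAt Gc (fderiv ℝ Gc (ℓ 0)) (ℓ 0) := by
      rw [hℓ0]; exact c.hasFDerivAt_G_chart_symm p hp hzt
    have h1 := hGcd'.comp_hasDerivAt 0 hℓd
    rwa [hℓ0] at h1
  -- the explicit form of `Fc ∘ ℓ` near `0`
  have hev : (fun s => (c.a - z 0 - s) + β (z 0 + s) * ((Gc ∘ ℓ) s - c.a' + (z 0 + s))) =ᶠ[𝓝 0] Fc ∘ ℓ := by
    have hcont : Continuous ℓ := by fun_prop
    have hmem : ∀ᶠ s in 𝓝 (0 : ℝ), ℓ s ∈ Θ.target := by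
      refine hcont.continuousAt.preimage_mem_nhds ?_
      rw [hℓ0]; exact Θ.open_target.mem_nhds hzt
    filter_upwards [hmem] with s hs
    have hf : c.f (Θ.symm (ℓ s)) = c.a - (z 0 + s) := by rw [c.f_chart_symm p hp hs, hℓs]
    have harg : c.a - c.f (Θ.symm (ℓ s)) = z 0 + s := by rw [hf]; ring
    show _ = c.splice L s₀ (Θ.symm (ℓ s))
    unfold splice
    rw [harg, hf]
    simp only [hGc, hβ, comp_apply]
    ring
  -- its derivative at `0`
  have hβd : HasDerivAt (fun s => β (z 0 + s)) (deriv (spliceProfile L s₀) (z 0)) 0 := by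
    have h : HasDerivAt (spliceProfile L s₀) (deriv (spliceProfile L s₀) (z 0)) (z 0 + 0) := by
      rw [add_zero]
      exact (hasDerivAt_spliceProfile hL hs₀ hz0pos).differentiableAt.hasDerivAt
    exact h.comp_const_add (z 0) 0
  have hterm1 : HasDerivAt (fun s : ℝ => c.a - z 0 - s) (-1) 0 := (hasDerivAt_id (0 : ℝ)).const_sub _
  have hterm3 : HasDerivAt (fun s => (Gc ∘ ℓ) s - c.a' + (z 0 + s)) (fderiv ℝ Gc z e₀ + 1) 0 := by
    have h2 : HasDerivAt (fun s : ℝ => z 0 + s) 1 0 := (hasDerivAt_id (0 : ℝ)).const_add _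
    exact (hG1.sub_const c.a').add h2
  have hexpl := hterm1.add (hβd.mul hterm3)
  have hD := (hexpl.congr_of_eventuallyEq hev.symm).unique hline0
  -- the sign of the derivative
  simp only [comp_apply, hℓ0, add_zero] at hD
  have hGz : Gc z = c.G (Θ.symm z) := rfl
  set β₀ := β (z 0) with hβ₀
  set b' := deriv (spliceProfile L s₀) (z 0) with hb'
  set g' := fderiv ℝ Gc z e₀ with hg'
  set H := Gc z - c.a' + z 0 with hH
  have hβI : β₀ ∈ Icc (0 : ℝ) 1 := spliceProfile_mem_Icc L s₀ (z 0)
  have hg'le : g' ≤ -lam := hder z hxb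
  have hHle : |H| ≤ C * z 0 := hhad z hxb hz0pos.le
  have hkey : |z 0 * b'| ≤ smoothTransitionDerivBound / L := abs_mul_deriv_spliceProfile_le hL hs₀ hz0pos
  -- `b' H ≤ C₀ C / L`
  have herr : b' * H ≤ smoothTransitionDerivBound * C / L := by
    have h1 : b' * H ≤ |b'| * |H| := by
      rw [← abs_mul]; exact le_abs_self _
    have h2 : |b'| * |H| ≤ |b'| * (C * z 0) := mul_le_mul_of_nonneg_left hHle (abs_nonneg _)
    have h3 : |b'| * (C * z 0) = |z 0 * b'| * C := by
      rw [abs_mul, abs_of_pos hz0pos]; ring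
    have h4 : |z 0 * b'| * C ≤ smoothTransitionDerivBound / L * C := mul_le_mul_of_nonneg_right hkey hC
    have h5 : smoothTransitionDerivBound / L * C = smoothTransitionDerivBound * C / L := by ring
    linarith
  -- `-(1 - β₀) + β₀ g' ≤ -min 1 λ`
  have hmain : -(1 - β₀) + β₀ * g' ≤ -min 1 lam := by
    have hm1 : min 1 lam ≤ 1 := min_le_left _ _
    have hm2 : min 1 lam ≤ lam := min_le_right _ _
    nlinarith [hβI.1, hβI.2]
  have hLC' : smoothTransitionDerivBound * C / L < min 1 lam := by
    rw [div_lt_iff₀ hL]; linarith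
  -- the derivative equals `-(1 - β₀) + β₀ g' + b' H < 0`, contradiction
  have hDval : -1 + (b' * H + β₀ * (g' + 1)) = -(1 - β₀) + β₀ * g' + b' * H := by ring
  have : -(1 - β₀) + β₀ * g' + b' * H < 0 := by linarith
  rw [← hDval] at this
  exact this.ne hD

end Splice

/-! ### §4 Collar bounds and the regularity of the splice on the collar -/

/-- **Uniform collar bounds** for the comparison data: a collar width `s > 0` and constants
`λ > 0`, `C ≥ 0` such that every point of the closed collar `{a - s ≤ f ≤ a}` lies in a good
chart ball (`exists_collar`). [folklore] -/
structure CollarBound where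
  /-- The collar width. -/
  s : ℝ
  /-- The bound `∂₀(G ∘ Θ⁻¹) ≤ -λ`. -/
  lam : ℝ
  /-- The Hadamard constant. -/
  C : ℝ
  s_pos : 0 < s
  lam_pos : 0 < lam
  C_nonneg : 0 ≤ C
  spec : ∀ x, c.a - s ≤ c.f x → c.f x ≤ c.a →
    ∃ (p : M) (hp : c.f p = c.a) (r : ℝ),
      closedBall (c.chart p hp.le p) r ⊆ (c.chart p hp.le).target ∧
      x ∈ (c.chart p hp.le).source ∧ c.chart p hp.le x ∈ ball (c.chart p hp.le p) r ∧
      (∀ z ∈ ball (c.chart p hp.le p) r, fderiv ℝ (c.G ∘ (c.chart p hp.le).symm) z e₀ ≤ -lam) ∧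
      (∀ z ∈ ball (c.chart p hp.le p) r, 0 ≤ z 0 →
        |c.G ((c.chart p hp.le).symm z) - c.a' + z 0| ≤ C * z 0)

/-- Collar bounds exist on a compact `M`. [folklore] -/
theorem nonempty_collarBound [CompactSpace M] : Nonempty c.CollarBound := by
  obtain ⟨s, lam, C, hs, hlam, hC, h⟩ := c.exists_collar
  exact ⟨⟨s, lam, C, hs, hlam, hC, h⟩⟩

namespace CollarBound

variable {c} (B : c.CollarBound)

/-- The threshold `L₀ = C₀ C / min(1, λ)` beyond which the splice is regular on the collar.
[folklore] -/
def L₀ : ℝ := smoothTransitionDerivBound * B.C / min 1 B.lam + 1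

/-- `L₀ > 0`. [folklore] -/
theorem L₀_pos : 0 < B.L₀ := by
  unfold L₀
  have : 0 ≤ smoothTransitionDerivBound * B.C / min 1 B.lam :=
    div_nonneg (mul_nonneg smoothTransitionDerivBound_pos.le B.C_nonneg) (le_min zero_le_one B.lam_pos.le)
  linarith

/-- For `L ≥ L₀`, `C₀ C < L min(1, λ)`. [folklore] -/
theorem lt_of_L₀_le {L : ℝ} (hL : B.L₀ ≤ L) : smoothTransitionDerivBound * B.C < L * min 1 B.lam := by
  have hm : 0 < min 1 B.lam := lt_min one_pos B.lam_pos
  unfold L₀ at hL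
  have h1 : smoothTransitionDerivBound * B.C / min 1 B.lam < L := by linarith
  rwa [div_lt_iff₀ hm] at h1

/-- **The splice has no critical points on the collar** `{a - s ≤ f < a}`, for `L ≥ L₀` and any
`s₀ > 0`. [cite: MilnorHCobordism1965, proof of Thm. 3.13] -/
theorem not_isMCriticalPt_splice {L s₀ : ℝ} (hL : B.L₀ ≤ L) (hs₀ : 0 < s₀) {x : M}
    (h1 : c.a - B.s ≤ c.f x) (h2 : c.f x < c.a) : ¬ IsMCriticalPt (𝓡∂ (k + 1)) (c.splice L s₀) x := by
  obtain ⟨p, hp, r, -, hxs, hxb, hder, hhad⟩ := B.spec x h1 h2.le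
  exact c.not_isMCriticalPt_splice_of_ball (B.L₀_pos.trans_le hL) hs₀ B.C_nonneg (B.lt_of_L₀_le hL)
    hp hder hhad hxs hxb h2

/-- **Lower bound for `G` on the collar**: `a' - (C + 1)(a - f) ≤ G` on `{a - s ≤ f ≤ a}` (the
Hadamard bound at `Θ x`, where `G ∘ Θ⁻¹ (Θ x) = G x` and `z₀ = a - f x`). [folklore] -/
theorem G_ge {x : M} (h1 : c.a - B.s ≤ c.f x) (h2 : c.f x ≤ c.a) :
    c.a' - (B.C + 1) * (c.a - c.f x) ≤ c.G x := by
  obtain ⟨p, hp, r, -, hxs, hxb, -, hhad⟩ := B.spec x h1 h2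
  have hz0 : c.chart p hp.le x 0 = c.a - c.f x := c.chart_apply_zero p hp hxs
  have h := hhad (c.chart p hp.le x) hxb (by rw [hz0]; linarith)
  rw [(c.chart p hp.le).left_inv hxs, hz0] at h
  have := neg_abs_le (c.G x - c.a' + (c.a - c.f x))
  nlinarith

end CollarBound

end LevelComparison

end Literature.Topology.FourManifolds

end
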